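/-
Copyright (c) 2026 the pub-hodgecm-mathlib formalisation cell (harness21).  Prover seat hodgecm-mathlib-LH4-p08 (g11) (valve hand), Track B «K2-LIT»,
#184♮ = hLiu418 = `stmt-HodgeConjecture-24832`; socket #41, KIND W — (KW-arch-hBL) brick (3d-i) FILE 2b′ (KW desk F0P2-p08 (g4) 01:27:44Z; K2E4-p10 (g10)'s
finding 01:24:20Z): the growth constants ∃-bound BEFORE `∀ g`.  THEOREMS ONLY (no `def`, no `instance`, no notation, no named-fact hypothesis, no `sorry`).
-/
import Summits.HodgeConjecture.HodgeConjecture.Theorems.K2LiuKindWArchWhittakerGrowthNegDef   -- ★ 2c ⊇ ★ 2b ⊇ ★ 2a ⊇ ★ p863756 ⊇ ★ p863627 ⊇ ★ p863390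
import HarnessLib

/-!
# Crux `HLiu418`, socket #41, KIND W — `K2LiuKindWArchWhittakerGrowthAtOnePic`: GROWTH OF THE CONTINUED PER-PLACE WHITTAKER LETTERS WITH CONSTANTS
# UNIFORM IN THE GROUP VARIABLE (Siegel-form decompositions, `u₀ = 1`) — the engine, generic in the picture predicate

Cell `hodgecm-mathlib`, crux item hLiu418 = `stmt-HodgeConjecture-24832` (helper lane `--supports … --as helper`, count-neutral), route of record `HCCMUnconditional`;
squad K2 ∕ K2Liu, socket #41, KIND W, (iii-arch) block letter `hBL`.  ★ FILE 2b∕2c (`K2LiuKindWArchWhittakerGrowth{,NegDef}`) bind the index `hidx` and the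
group element `g` BEFORE the colon, so their growth constants may depend on them (through the K-picture polynomial `P(u₀(g))`; K2E4-p10 (g10), KW desk
F0P2-p08 (g4) 01:37:39Z).  THIS FILE exports the constants ∃-bound BEFORE `∀ hidx ∀ g` on the SIEGEL-FORM decompositions `diag(C,−B)·g = n(X₀)·diag(R,R⁻¹)`
(`u₀ = 1`, K-picture polynomial `P(1)` fixed once, ★ JUNCTION uniform in the positive definite index): `Cg = 8⁻¹·‖det C‖⁻⁴·C_JUNCTION(P(1), ball)`.
* §1 **`twistedWhittaker_explicit_of_siegelForm_pic`** — ★ p864015's explicit letter RE-RUN with the index, the twist and the Siegel-form decomposition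
  SUPPLIED after `(FJ, s₀)` (obtained ONCE from `P(1)`); §2 **`exists_growth_constants_of_posDef_pic`** — the FAMILY `Ew : (hidx, g) ↦ Ew hidx g` (hol +
  formula for every positive definite index and every `g ∈ U(J)`) and the (ii″) face with constants BEFORE `∀ hidx ∀ g` over the Siegel-form decompositions
  (two differ by a unitary, ★ `levi_letters_unique` at `u₀ = u₁ = 1`); the heads at the `evalAt … Q` picture are the sibling file `K2LiuKindWArchWhittakerGrowthAtOne`.
[Shimura1997, §16.4, §18.4] [KudlaRallis1994, §1].
HONEST LABEL.  Count-neutral helper, closes no socket: `HC_CM` is proved only modulo the 7 printed citations (2 remaining named inputs: hLiu418 =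
`stmt-HodgeConjecture-24832`, h413 = `stmt-HodgeConjecture-24833`) until rung 0 closes.
-/

set_option autoImplicit false
set_option linter.dupNamespace false -- the mandated namespace repeats `HodgeConjecture.HodgeConjecture`

noncomputable section

open Complex Matrix MeasureTheory
open scoped ComplexConjugate ComplexOrder
open Literature.NumberTheory.ModularForms.SiegelUpperHalfSpace (moeb num denom moeb_def num_fromBlocks denom_fromBlocks moeb_one)

namespace Summit.HodgeConjecture.HodgeConjecture.Cruxes.HLiu418.K2LiuKindWArchWhittakerGrowthAtOnePic

open Summit.HodgeConjecture.HodgeConjecture.Cruxes.HLiu418.K2LiuHermTwoGammaDefs (hermTwo hermTwo_eq_of_isHermitian)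
open Summit.HodgeConjecture.HodgeConjecture.Cruxes.HLiu418.K2LiuHermTwoEtaDefs (hermTwo_add)
open Summit.HodgeConjecture.HodgeConjecture.Cruxes.HLiu418.K2LiuArchInducedTubeDefs
open Summit.HodgeConjecture.HodgeConjecture.Cruxes.HLiu418.K2LiuU22CompactPictureDefs
open Summit.HodgeConjecture.HodgeConjecture.Cruxes.HLiu418.K2LiuArchWhittakerLeviEquivariance
open Summit.HodgeConjecture.HodgeConjecture.Cruxes.HLiu418.K2LiuArchIntertwiningScalarValue (integral_hermOfReal_eq)
open Summit.HodgeConjecture.HodgeConjecture.Cruxes.HLiu418.K2LiuArchBlockOfFrame (antidiag_letters antidiag_eq_J_mul_levi levi_mul_transl)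
open Summit.HodgeConjecture.HodgeConjecture.Cruxes.HLiu418.K2LiuKFiniteSectionWhittakerHolomorphyGrowth (kFiniteSection_whittaker_holomorphy_growth)

open Summit.HodgeConjecture.HodgeConjecture.Cruxes.HLiu418.K2LiuKindWArchWhittakerLetterNegDef
open Summit.HodgeConjecture.HodgeConjecture.Cruxes.HLiu418.K2LiuKindWArchWhittakerGrowth

/-! ## §1 The explicit letter with the Siegel-form decomposition supplied -/

/-- **THE TWISTED UNIPOTENT INTEGRAL WRITTEN OUT, SIEGEL-FORM DECOMPOSITION SUPPLIED (`u₀ = 1`).**  The K-picture polynomial `P := hKpic 1` and ★ JUNCTION's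
`(FJ, s₀)` are obtained ONCE; then for EVERY `g ∈ U(J)` and EVERY decomposition `diag(C,−B)·g = n(X₀)·diag(R,R⁻¹)` (`X₀` hermitian, `R` hermitian invertible)
and every flat section with picture `Pic` at `s₀ < re s`:
`∫ F(x·n(b)·g)·eb(b) db = 8⁻¹·‖det C‖⁻⁴·e(tr(h₁X₀))·χ_k(det R⁻¹)·‖det R‖^{2−2s}·FJ (Rᴴ h₁ R) s`, `h₁ = C⁻ᴴ·hidx·C⁻¹` (★ p864015's Steps A–D verbatim at `u₀ = 1`).
[cite: Shimura1997, §16.4, §18.4] [cite: KudlaRallis1994, §1] -/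
theorem twistedWhittaker_explicit_of_siegelForm_pic (k : ℤ)
    (Pic : ℂ → (Matrix (Fin 2 ⊕ Fin 2) (Fin 2 ⊕ Fin 2) ℂ → ℂ) → Prop)
    {B C : Matrix (Fin 2) (Fin 2) ℂ}
    (hx : (fromBlocks 0 B C 0 : Matrix (Fin 2 ⊕ Fin 2) (Fin 2 ⊕ Fin 2) ℂ)ᴴ * Matrix.J (Fin 2) ℂ * (fromBlocks 0 B C 0 : Matrix (Fin 2 ⊕ Fin 2) (Fin 2 ⊕ Fin 2) ℂ) =
      Matrix.J (Fin 2) ℂ)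
    (hKpic : ∀ k₀ : Matrix (Fin 2 ⊕ Fin 2) (Fin 2 ⊕ Fin 2) ℂ, k₀ᴴ * Matrix.J (Fin 2) ℂ * k₀ = Matrix.J (Fin 2) ℂ →
      moeb k₀ (I • (1 : Matrix (Fin 2) (Fin 2) ℂ)) = I • 1 →
      ∃ P : MvPolynomial (((Fin 2 ⊕ Fin 2) × (Fin 2 ⊕ Fin 2)) ⊕ ((Fin 2 ⊕ Fin 2) × (Fin 2 ⊕ Fin 2))) ℂ,
        ∀ (s : ℂ) (F : Matrix (Fin 2 ⊕ Fin 2) (Fin 2 ⊕ Fin 2) ℂ → ℂ), IsArchSiegelSection (fun z : ℂ => (conj z / ((‖z‖ : ℝ) : ℂ)) ^ k) s F →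
          Pic s F →
          ∀ u : Matrix (Fin 2 ⊕ Fin 2) (Fin 2 ⊕ Fin 2) ℂ, uᴴ * Matrix.J (Fin 2) ℂ * u = Matrix.J (Fin 2) ℂ → moeb u (I • (1 : Matrix (Fin 2) (Fin 2) ℂ)) = I • 1 →
            F (u * k₀) = MvPolynomial.eval (Sum.elim (fun pq => u pq.1 pq.2) (fun pq => conj (u pq.1 pq.2))) P) :
    ∃ (FJ : Matrix (Fin 2) (Fin 2) ℂ → ℂ → ℂ) (s₀ : ℝ),
      (∀ {U : Set ℂ}, IsOpen U → (∀ s ∈ U, 0 < (s + 1 + (k : ℂ) / 2).re) →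
        ∀ {h : Matrix (Fin 2) (Fin 2) ℂ}, h.PosDef → DifferentiableOn ℂ (FJ h) U) ∧
      (∀ {K : Set ℂ}, IsCompact K → (∀ s ∈ K, 0 < (s + 1 + (k : ℂ) / 2).re) →
        ∃ Cg N N' : ℝ, 0 ≤ Cg ∧ 0 ≤ N ∧ 0 ≤ N' ∧ ∀ h : Matrix (Fin 2) (Fin 2) ℂ, h.PosDef → ∀ s ∈ K,
          ‖FJ h s‖ ≤ Cg * Real.exp (-(Real.pi * ((h 0 0).re + (h 1 1).re))) * (1 + ((h 0 0).re + (h 1 1).re)) ^ N *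
            (1 + ((h 0 0).re * (h 1 1).re - normSq (h 0 1)) ^ (-N'))) ∧
      ∀ hidx : Matrix (Fin 2) (Fin 2) ℂ, hidx.PosDef → ∀ eb : Matrix (Fin 2) (Fin 2) ℂ → ℂ, (∀ b, eb b = cexp (-(2 * Real.pi * I) * (hidx * b).trace)) →
      ∀ g : Matrix (Fin 2 ⊕ Fin 2) (Fin 2 ⊕ Fin 2) ℂ, gᴴ * Matrix.J (Fin 2) ℂ * g = Matrix.J (Fin 2) ℂ →
        ∀ (X₀ R : Matrix (Fin 2) (Fin 2) ℂ), X₀ᴴ = X₀ → Rᴴ = R → IsUnit R.det →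
          (fromBlocks C 0 0 (-B) : Matrix (Fin 2 ⊕ Fin 2) (Fin 2 ⊕ Fin 2) ℂ) * g = fromBlocks 1 X₀ 0 1 * fromBlocks R 0 0 R⁻¹ →
          ∀ s : ℂ, s₀ < s.re →
            ∀ F : Matrix (Fin 2 ⊕ Fin 2) (Fin 2 ⊕ Fin 2) ℂ → ℂ, IsArchSiegelSection (fun z : ℂ => (conj z / ((‖z‖ : ℝ) : ℂ)) ^ k) s F → Pic s F →
              ∫ r : Fin 2 → Fin 2 → ℝ, F ((fromBlocks 0 B C 0 : Matrix (Fin 2 ⊕ Fin 2) (Fin 2 ⊕ Fin 2) ℂ) * fromBlocks 1 (hermOfReal r) 0 1 * g) * eb (hermOfReal r) =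
                (1 / 8 : ℂ) * (((((‖C.det‖ : ℝ) : ℂ) ^ 4)⁻¹) * (cexp ((2 * Real.pi * I) * (((C⁻¹)ᴴ * hidx * C⁻¹) * X₀).trace) *
                  ((fun z : ℂ => (conj z / ((‖z‖ : ℝ) : ℂ)) ^ k) R⁻¹.det * (((‖R.det‖ : ℝ) : ℂ) ^ (2 - 2 * s) * FJ (Rᴴ * ((C⁻¹)ᴴ * hidx * C⁻¹) * R) s)))) := by
  -- the K-picture polynomial of the UN-translated sections and the JUNCTION, ONCE
  have h1J : (1 : Matrix (Fin 2 ⊕ Fin 2) (Fin 2 ⊕ Fin 2) ℂ)ᴴ * Matrix.J (Fin 2) ℂ * 1 = Matrix.J (Fin 2) ℂ := by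
    rw [conjTranspose_one, Matrix.one_mul, Matrix.mul_one]
  obtain ⟨P, hP1⟩ := hKpic 1 h1J (moeb_one _)
  obtain ⟨FJ, s₀, hFJhol, hFJgr, hFJint⟩ := kFiniteSection_whittaker_holomorphy_growth P k
  refine ⟨FJ, s₀, hFJhol, hFJgr, fun hidx hpos eb heb g _ X₀ R hX₀ hR hRu hdec s hs F hF hFQ => ?_⟩
  obtain ⟨u₀, hu₀def⟩ : ∃ u₀ : Matrix (Fin 2 ⊕ Fin 2) (Fin 2 ⊕ Fin 2) ℂ, u₀ = 1 := ⟨1, rfl⟩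
  have hg'eq : (fromBlocks C 0 0 (-B) : Matrix (Fin 2 ⊕ Fin 2) (Fin 2 ⊕ Fin 2) ℂ) * g = fromBlocks 1 X₀ 0 1 * fromBlocks R 0 0 R⁻¹ * u₀ := by
    rw [hu₀def, Matrix.mul_one]; exact hdec
  have hP : ∀ (s : ℂ) (F : Matrix (Fin 2 ⊕ Fin 2) (Fin 2 ⊕ Fin 2) ℂ → ℂ), IsArchSiegelSection (fun z : ℂ => (conj z / ((‖z‖ : ℝ) : ℂ)) ^ k) s F →
      Pic s F → ∀ u : Matrix (Fin 2 ⊕ Fin 2) (Fin 2 ⊕ Fin 2) ℂ, uᴴ * Matrix.J (Fin 2) ℂ * u = Matrix.J (Fin 2) ℂ →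
        moeb u (I • (1 : Matrix (Fin 2) (Fin 2) ℂ)) = I • 1 →
        F (u * u₀) = MvPolynomial.eval (Sum.elim (fun pq => u pq.1 pq.2) (fun pq => conj (u pq.1 pq.2))) P := by
    rw [hu₀def]; exact hP1
  /- §0 frame letters -/
  obtain ⟨hCB, hBC⟩ := antidiag_letters hx
  have hC : C.det ≠ 0 := (Matrix.isUnit_det_of_left_inverse hBC).ne_zero
  have hCu : IsUnit C.det := isUnit_iff_ne_zero.2 hC
  have hCiC : C⁻¹ * C = 1 := Matrix.nonsing_inv_mul C hCu
  have hCCi : C * C⁻¹ = 1 := Matrix.mul_nonsing_inv C hCu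
  have hRRi : R * R⁻¹ = 1 := Matrix.mul_nonsing_inv R hRu
  have hRiR : R⁻¹ * R = 1 := Matrix.nonsing_inv_mul R hRu
  have had : Rᴴ * R⁻¹ = 1 := by rw [hR, hRRi]
  have hRdet : R.det ≠ 0 := hRu.ne_zero
  /- §2 the two index changes and the JUNCTION at the final index -/
  set h₁ : Matrix (Fin 2) (Fin 2) ℂ := (C⁻¹)ᴴ * hidx * C⁻¹ with hh₁
  set h₂ : Matrix (Fin 2) (Fin 2) ℂ := Rᴴ * h₁ * R with hh₂
  have hCiu : IsUnit C⁻¹ := by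
    rw [Matrix.isUnit_iff_isUnit_det]; exact Matrix.isUnit_det_of_left_inverse hCCi
  have hRu' : IsUnit R := (Matrix.isUnit_iff_isUnit_det R).2 hRu
  have h₁pos : h₁.PosDef := hpos.conjTranspose_mul_mul_same (Matrix.mulVec_injective_iff_isUnit.2 hCiu)
  have h₂pos : h₂.PosDef := h₁pos.conjTranspose_mul_mul_same (Matrix.mulVec_injective_iff_isUnit.2 hRu')
  /- the constants -/
  set χ : ℂ → ℂ := fun z : ℂ => (conj z / ((‖z‖ : ℝ) : ℂ)) ^ k with hχ
  set K₀ : ℂ := cexp ((2 * Real.pi * I) * (h₁ * X₀).trace) with hK₀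
  show _ = (1 / 8 : ℂ) * (((((‖C.det‖ : ℝ) : ℂ) ^ 4)⁻¹) * (K₀ * (χ R⁻¹.det * (((‖R.det‖ : ℝ) : ℂ) ^ (2 - 2 * s) * FJ h₂ s))))
  /- §4 the identity at `s₀ < re s` (★ p863627's Steps A–D verbatim) -/
  set f : Matrix (Fin 2 ⊕ Fin 2) (Fin 2 ⊕ Fin 2) ℂ → ℂ := fun y => F (y * u₀) with hf
  have hfS : IsArchSiegelSection χ s f := isArchSiegelSection_rightTranslate hF u₀
  have hfK : ∀ u : Matrix (Fin 2 ⊕ Fin 2) (Fin 2 ⊕ Fin 2) ℂ, uᴴ * Matrix.J (Fin 2) ℂ * u = Matrix.J (Fin 2) ℂ →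
      moeb u (I • (1 : Matrix (Fin 2) (Fin 2) ℂ)) = I • 1 →
      f u = MvPolynomial.eval (Sum.elim (fun pq => u pq.1 pq.2) (fun pq => conj (u pq.1 pq.2))) P :=
    fun u hu hui => hP s F hF hFQ u hu hui
  -- the twist read at `h₁`: `eb X = e₁ (C X Cᴴ)`
  have heb₁ : ∀ X : Matrix (Fin 2) (Fin 2) ℂ, eb X = cexp (-(2 * Real.pi * I) * (h₁ * (C * X * Cᴴ)).trace) := by
    intro X
    rw [heb, trace_mul_conj h₁ C X, hh₁]
    congr 3
    rw [show Cᴴ * ((C⁻¹)ᴴ * hidx * C⁻¹) * C = (C⁻¹ * C)ᴴ * hidx * (C⁻¹ * C) by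
      rw [Matrix.conjTranspose_mul]; simp only [Matrix.mul_assoc], hCiC, Matrix.conjTranspose_one, Matrix.one_mul, Matrix.mul_one]
  -- the frame algebra: `x · n(X) · g = J · n(C X Cᴴ) · g'`
  have e1 : ∀ X : Matrix (Fin 2) (Fin 2) ℂ, (fromBlocks 0 B C 0 : Matrix (Fin 2 ⊕ Fin 2) (Fin 2 ⊕ Fin 2) ℂ) * fromBlocks 1 X 0 1 * g =
      Matrix.J (Fin 2) ℂ * fromBlocks 1 (C * X * Cᴴ) 0 1 * (fromBlocks C 0 0 (-B) * g) := by
    intro X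
    rw [antidiag_eq_J_mul_levi, Matrix.mul_assoc (Matrix.J (Fin 2) ℂ), levi_mul_transl hCB, ← Matrix.mul_assoc (Matrix.J (Fin 2) ℂ),
      Matrix.mul_assoc _ _ g]
  -- the Iwasawa rewriting: `J · n(Y) · g' = (J · n(Y + X₀) · m(R,R⁻¹)) · u₀`
  have e2 : ∀ Y : Matrix (Fin 2) (Fin 2) ℂ, Matrix.J (Fin 2) ℂ * fromBlocks 1 Y 0 1 * (fromBlocks C 0 0 (-B) * g) =
      Matrix.J (Fin 2) ℂ * fromBlocks 1 (Y + X₀) 0 1 * fromBlocks R 0 0 R⁻¹ * u₀ := by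
    intro Y
    have hn : (fromBlocks 1 Y 0 1 : Matrix (Fin 2 ⊕ Fin 2) (Fin 2 ⊕ Fin 2) ℂ) * fromBlocks 1 X₀ 0 1 = fromBlocks 1 (Y + X₀) 0 1 := by
      rw [fromBlocks_multiply]; simp [add_comm]
    rw [hg'eq, ← hn]
    simp only [Matrix.mul_assoc]
  -- the twisted integrand in the two charts
  set G : Matrix (Fin 2) (Fin 2) ℂ → ℂ := fun Y =>
    F (Matrix.J (Fin 2) ℂ * fromBlocks 1 Y 0 1 * (fromBlocks C 0 0 (-B) * g)) * cexp (-(2 * Real.pi * I) * (h₁ * Y).trace) with hG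
  set c₀ : ℝ × ℂ × ℝ := ((X₀ 0 0).re, X₀ 0 1, (X₀ 1 1).re) with hc₀
  have hX₀c : hermTwo c₀ = X₀ := hermTwo_eq_of_isHermitian hX₀
  set G₂ : ℝ × ℂ × ℝ → ℂ := fun c =>
    f (Matrix.J (Fin 2) ℂ * fromBlocks 1 (hermTwo c) 0 1 * fromBlocks R 0 0 R⁻¹) * cexp (-(2 * Real.pi * I) * (h₁ * hermTwo c).trace) * K₀ with hG₂
  -- Step A+B: chart and frame algebra, pointwise
  have hAB : ∀ X : Matrix (Fin 2) (Fin 2) ℂ,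
      F ((fromBlocks 0 B C 0 : Matrix (Fin 2 ⊕ Fin 2) (Fin 2 ⊕ Fin 2) ℂ) * fromBlocks 1 X 0 1 * g) * eb X = G (C * X * Cᴴ) := by
    intro X; rw [hG, e1, heb₁]
  -- Step D pointwise: `G (hermTwo c) = G₂ (c₀ + c)`
  have hD : ∀ c : ℝ × ℂ × ℝ, G (hermTwo c) = G₂ (c₀ + c) := by
    intro c
    have hY : hermTwo (c₀ + c) = hermTwo c + X₀ := by rw [hermTwo_add, hX₀c, add_comm]
    simp only [hG, hG₂, hf]
    rw [e2, hY, mul_assoc (F _)]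
    congr 1
    rw [hK₀, ← Complex.exp_add]
    congr 1
    rw [Matrix.mul_add, Matrix.trace_add]
    ring
  -- Lebesgue measure on the chart `ℝ × ℂ × ℝ` is an additive Haar measure (as in ★ `integral_hermOfReal_eq`)
  haveI hCvol : ((volume : Measure ℂ).prod (volume : Measure ℝ)).IsAddHaarMeasure := Measure.prod.instIsAddHaarMeasure _ _
  haveI : (volume : Measure (ℝ × ℂ × ℝ)).IsAddHaarMeasure := by
    rw [show (volume : Measure (ℝ × ℂ × ℝ)) = (volume : Measure ℝ).prod ((volume : Measure ℂ).prod (volume : Measure ℝ)) from rfl]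
    exact Measure.prod.instIsAddHaarMeasure _ _
  calc ∫ r : Fin 2 → Fin 2 → ℝ, F ((fromBlocks 0 B C 0 : Matrix (Fin 2 ⊕ Fin 2) (Fin 2 ⊕ Fin 2) ℂ) * fromBlocks 1 (hermOfReal r) 0 1 * g) * eb (hermOfReal r)
      = (1 / 8 : ℂ) * ∫ c : ℝ × ℂ × ℝ, G (C * hermTwo c * Cᴴ) := by
        rw [integral_hermOfReal_eq (fun X => F ((fromBlocks 0 B C 0 : Matrix (Fin 2 ⊕ Fin 2) (Fin 2 ⊕ Fin 2) ℂ) * fromBlocks 1 X 0 1 * g) * eb X)]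
        simp only [hAB]
    _ = (1 / 8 : ℂ) * ((((‖C.det‖ : ℝ) : ℂ) ^ 4)⁻¹ * ∫ c : ℝ × ℂ × ℝ, G (hermTwo c)) := by
        congr 1
        rw [integral_comp_hermTwo_conj hC G, Complex.real_smul, ofReal_pow, ← mul_assoc,
          inv_mul_cancel₀ (pow_ne_zero _ (ofReal_ne_zero.2 (norm_pos_iff.2 hC).ne')), one_mul]
    _ = (1 / 8 : ℂ) * ((((‖C.det‖ : ℝ) : ℂ) ^ 4)⁻¹ * ∫ c : ℝ × ℂ × ℝ, G₂ c) := by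
        simp only [hD]
        rw [integral_add_left_eq_self G₂ c₀]
    _ = (1 / 8 : ℂ) * ((((‖C.det‖ : ℝ) : ℂ) ^ 4)⁻¹ * (K₀ *
          ∫ c : ℝ × ℂ × ℝ, f (Matrix.J (Fin 2) ℂ * fromBlocks 1 (hermTwo c) 0 1 * fromBlocks R 0 0 R⁻¹) *
            cexp (-(2 * Real.pi * I) * (h₁ * hermTwo c).trace))) := by
        rw [hG₂, integral_mul_const, mul_comm _ K₀]
    _ = (1 / 8 : ℂ) * ((((‖C.det‖ : ℝ) : ℂ) ^ 4)⁻¹ * (K₀ * (χ R⁻¹.det * (((‖R.det‖ : ℝ) : ℂ) ^ (2 - 2 * s) *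
          ∫ c : ℝ × ℂ × ℝ, f (Matrix.J (Fin 2) ℂ * fromBlocks 1 (hermTwo c) 0 1) * cexp (-(2 * Real.pi * I) * (h₂ * hermTwo c).trace))))) := by
        rw [whittaker_levi_equivariance hfS had h₁, hh₂, mul_assoc (χ R⁻¹.det)]
    _ = (1 / 8 : ℂ) * ((((‖C.det‖ : ℝ) : ℂ) ^ 4)⁻¹ * (K₀ * (χ R⁻¹.det * (((‖R.det‖ : ℝ) : ℂ) ^ (2 - 2 * s) * FJ h₂ s)))) := by
        rw [hFJint h₂ h₂pos s hs f hfS hfK]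

/-! ## §2 The family of continuations with growth constants uniform over the Siegel-form decompositions -/

/-- **THE FAMILY `Ew : g ↦ Ew g` WITH GROWTH CONSTANTS ∃-BOUND BEFORE `∀ g` (positive definite index, generic picture predicate).**  For every `g ∈ U(J)`:
`Ew g` is holomorphic on `{0 < re}` and equals the twisted unipotent integral of every flat section with picture `Pic` on some `{s₀ < re}` (§1's formula at a
Siegel-form decomposition of `diag(C,−B)·g` when one exists — `u₀ = 1`, K-picture `P(1)` fixed once —, ★ 2b's continuation otherwise); and for every `z` with
`0 < re z` there are constants `Cg ≥ 0`, `cg = π∕2`, `N, N′ ≥ 0`, `r = re z∕2`, INDEPENDENT OF THE INDEX `hidx` AND OF `g`, such that for every positive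
definite `hidx`, every `g ∈ U(J)`, every Siegel-form
decomposition `diag(C,−B)·g = n(X₀)·diag(R,R⁻¹)` and `dist s z < r`:
`‖Ew g s‖ ≤ Cg·‖det R‖^{2−2re s}·e^{−cg·T₂}·(1+T₂)^N·(1+‖det(R h₁ R)‖^{−N′})` (the (ii″) face; two Siegel-form decompositions differ by a unitary `κ`,
★ `levi_letters_unique` at `u₀ = u₁ = 1`). [cite: Shimura1997, §16.4, §18.4] [cite: KudlaRallis1994, §1] -/
theorem exists_growth_constants_of_posDef_pic {k : ℤ} (hk : -2 ≤ k)
    (Pic : ℂ → (Matrix (Fin 2 ⊕ Fin 2) (Fin 2 ⊕ Fin 2) ℂ → ℂ) → Prop)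
    {B C : Matrix (Fin 2) (Fin 2) ℂ}
    (hx : (fromBlocks 0 B C 0 : Matrix (Fin 2 ⊕ Fin 2) (Fin 2 ⊕ Fin 2) ℂ)ᴴ * Matrix.J (Fin 2) ℂ * (fromBlocks 0 B C 0 : Matrix (Fin 2 ⊕ Fin 2) (Fin 2 ⊕ Fin 2) ℂ) =
      Matrix.J (Fin 2) ℂ)
    (hKpic : ∀ k₀ : Matrix (Fin 2 ⊕ Fin 2) (Fin 2 ⊕ Fin 2) ℂ, k₀ᴴ * Matrix.J (Fin 2) ℂ * k₀ = Matrix.J (Fin 2) ℂ →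
      moeb k₀ (I • (1 : Matrix (Fin 2) (Fin 2) ℂ)) = I • 1 →
      ∃ P : MvPolynomial (((Fin 2 ⊕ Fin 2) × (Fin 2 ⊕ Fin 2)) ⊕ ((Fin 2 ⊕ Fin 2) × (Fin 2 ⊕ Fin 2))) ℂ,
        ∀ (s : ℂ) (F : Matrix (Fin 2 ⊕ Fin 2) (Fin 2 ⊕ Fin 2) ℂ → ℂ), IsArchSiegelSection (fun z : ℂ => (conj z / ((‖z‖ : ℝ) : ℂ)) ^ k) s F →
          Pic s F →
          ∀ u : Matrix (Fin 2 ⊕ Fin 2) (Fin 2 ⊕ Fin 2) ℂ, uᴴ * Matrix.J (Fin 2) ℂ * u = Matrix.J (Fin 2) ℂ → moeb u (I • (1 : Matrix (Fin 2) (Fin 2) ℂ)) = I • 1 →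
            F (u * k₀) = MvPolynomial.eval (Sum.elim (fun pq => u pq.1 pq.2) (fun pq => conj (u pq.1 pq.2))) P) :
    ∃ Ew : Matrix (Fin 2) (Fin 2) ℂ → Matrix (Fin 2 ⊕ Fin 2) (Fin 2 ⊕ Fin 2) ℂ → ℂ → ℂ,
      (∀ hidx : Matrix (Fin 2) (Fin 2) ℂ, hidx.PosDef → ∀ eb : Matrix (Fin 2) (Fin 2) ℂ → ℂ, (∀ b, eb b = cexp (-(2 * Real.pi * I) * (hidx * b).trace)) →
        ∀ g : Matrix (Fin 2 ⊕ Fin 2) (Fin 2 ⊕ Fin 2) ℂ, gᴴ * Matrix.J (Fin 2) ℂ * g = Matrix.J (Fin 2) ℂ →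
        DifferentiableOn ℂ (Ew hidx g) {s : ℂ | 0 < s.re} ∧
        ∃ s₀ : ℝ, ∀ s : ℂ, s₀ < s.re →
          ∀ F : Matrix (Fin 2 ⊕ Fin 2) (Fin 2 ⊕ Fin 2) ℂ → ℂ, IsArchSiegelSection (fun z : ℂ => (conj z / ((‖z‖ : ℝ) : ℂ)) ^ k) s F → Pic s F →
            ∫ r : Fin 2 → Fin 2 → ℝ, F ((fromBlocks 0 B C 0 : Matrix (Fin 2 ⊕ Fin 2) (Fin 2 ⊕ Fin 2) ℂ) * fromBlocks 1 (hermOfReal r) 0 1 * g) * eb (hermOfReal r) =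
              Ew hidx g s) ∧
      ∀ z : ℂ, 0 < z.re → ∃ Cg cg N N' r : ℝ, 0 ≤ Cg ∧ 0 < cg ∧ 0 ≤ N ∧ 0 ≤ N' ∧ 0 < r ∧
        ∀ hidx : Matrix (Fin 2) (Fin 2) ℂ, hidx.PosDef → ∀ eb : Matrix (Fin 2) (Fin 2) ℂ → ℂ, (∀ b, eb b = cexp (-(2 * Real.pi * I) * (hidx * b).trace)) →
        ∀ g : Matrix (Fin 2 ⊕ Fin 2) (Fin 2 ⊕ Fin 2) ℂ, gᴴ * Matrix.J (Fin 2) ℂ * g = Matrix.J (Fin 2) ℂ →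
          ∀ (X₀ R : Matrix (Fin 2) (Fin 2) ℂ), X₀ᴴ = X₀ → Rᴴ = R → IsUnit R.det →
            (fromBlocks C 0 0 (-B) : Matrix (Fin 2 ⊕ Fin 2) (Fin 2 ⊕ Fin 2) ℂ) * g = fromBlocks 1 X₀ 0 1 * fromBlocks R 0 0 R⁻¹ →
            ∀ s : ℂ, dist s z < r →
              ‖Ew hidx g s‖ ≤ Cg * ‖R.det‖ ^ (2 - 2 * s.re) * Real.exp (-(cg * ∑ a, ∑ b, ‖(R * ((C⁻¹)ᴴ * hidx * C⁻¹) * R) a b‖)) *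
                (1 + ∑ a, ∑ b, ‖(R * ((C⁻¹)ᴴ * hidx * C⁻¹) * R) a b‖) ^ N * (1 + ‖(R * ((C⁻¹)ᴴ * hidx * C⁻¹) * R).det‖ ^ (-N')) := by
  classical
  obtain ⟨FJ, s₀, hFJhol, hFJgr, hform⟩ := twistedWhittaker_explicit_of_siegelForm_pic k Pic hx hKpic
  /- the frame letters -/
  obtain ⟨-, hBC⟩ := antidiag_letters hx
  have hC : C.det ≠ 0 := (Matrix.isUnit_det_of_left_inverse hBC).ne_zero
  have hCu : IsUnit C.det := isUnit_iff_ne_zero.2 hC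
  have hCCi : C * C⁻¹ = 1 := Matrix.mul_nonsing_inv C hCu
  have hCiu : IsUnit C⁻¹ := by rw [Matrix.isUnit_iff_isUnit_det]; exact Matrix.isUnit_det_of_left_inverse hCCi
  have h₁pd : ∀ hidx : Matrix (Fin 2) (Fin 2) ℂ, hidx.PosDef → ((C⁻¹)ᴴ * hidx * C⁻¹).PosDef := fun hidx hpos =>
    hpos.conjTranspose_mul_mul_same (Matrix.mulVec_injective_iff_isUnit.2 hCiu)
  have hRpd : ∀ hidx : Matrix (Fin 2) (Fin 2) ℂ, hidx.PosDef → ∀ R : Matrix (Fin 2) (Fin 2) ℂ, Rᴴ = R → IsUnit R.det →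
      (R * ((C⁻¹)ᴴ * hidx * C⁻¹) * R).PosDef := by
    intro hidx hpos R hR hRu
    have hRu' : IsUnit R := (Matrix.isUnit_iff_isUnit_det R).2 hRu
    have h := (h₁pd hidx hpos).conjTranspose_mul_mul_same (Matrix.mulVec_injective_iff_isUnit.2 hRu')
    rwa [hR] at h
  have h1J : (1 : Matrix (Fin 2 ⊕ Fin 2) (Fin 2 ⊕ Fin 2) ℂ)ᴴ * Matrix.J (Fin 2) ℂ * 1 = Matrix.J (Fin 2) ℂ := by
    rw [conjTranspose_one, Matrix.one_mul, Matrix.mul_one]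
  have hwin : ∀ s : ℂ, 0 < s.re → 0 < (s + 1 + (k : ℂ) / 2).re := by
    intro s hs
    have hk' : (-2 : ℝ) ≤ (k : ℝ) := by exact_mod_cast hk
    have hre : (s + 1 + (k : ℂ) / 2).re = s.re + 1 + (k : ℝ) / 2 := by simp [Complex.add_re, Complex.div_ofNat_re]
    rw [hre]; linarith
  have hopen : IsOpen {s : ℂ | 0 < s.re} := isOpen_lt continuous_const Complex.continuous_re
  /- the explicit formula as a function of the index and a Siegel-form decomposition, its holomorphy and its norm -/
  set Φ : Matrix (Fin 2) (Fin 2) ℂ → Matrix (Fin 2) (Fin 2) ℂ → Matrix (Fin 2) (Fin 2) ℂ → ℂ → ℂ := fun hidx X₀ R s =>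
    (1 / 8 : ℂ) * (((((‖C.det‖ : ℝ) : ℂ) ^ 4)⁻¹) * (cexp ((2 * Real.pi * I) * (((C⁻¹)ᴴ * hidx * C⁻¹) * X₀).trace) *
      ((fun z : ℂ => (conj z / ((‖z‖ : ℝ) : ℂ)) ^ k) R⁻¹.det * (((‖R.det‖ : ℝ) : ℂ) ^ (2 - 2 * s) * FJ (Rᴴ * ((C⁻¹)ᴴ * hidx * C⁻¹) * R) s)))) with hΦ
  have hΦhol : ∀ hidx : Matrix (Fin 2) (Fin 2) ℂ, hidx.PosDef → ∀ X₀ R : Matrix (Fin 2) (Fin 2) ℂ, Rᴴ = R → IsUnit R.det →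
      DifferentiableOn ℂ (Φ hidx X₀ R) {s : ℂ | 0 < s.re} := by
    intro hidx hpos X₀ R hR hRu
    have hRpos : 0 < ‖R.det‖ := norm_pos_iff.2 hRu.ne_zero
    have hcpow : Differentiable ℂ (fun s : ℂ => ((‖R.det‖ : ℝ) : ℂ) ^ (2 - 2 * s)) :=
      Differentiable.const_cpow ((differentiable_const _).sub ((differentiable_const _).mul differentiable_id))
        (Or.inl (ofReal_ne_zero.2 hRpos.ne'))
    have hF2 : DifferentiableOn ℂ (FJ (Rᴴ * ((C⁻¹)ᴴ * hidx * C⁻¹) * R)) {s : ℂ | 0 < s.re} := by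
      rw [hR]; exact hFJhol hopen (fun s hs => hwin s hs) (hRpd hidx hpos R hR hRu)
    exact (differentiableOn_const _).mul ((differentiableOn_const _).mul ((differentiableOn_const _).mul
      ((differentiableOn_const _).mul (hcpow.differentiableOn.mul hF2))))
  have hΦnorm : ∀ hidx : Matrix (Fin 2) (Fin 2) ℂ, hidx.PosDef → ∀ X₀ R : Matrix (Fin 2) (Fin 2) ℂ, X₀ᴴ = X₀ → Rᴴ = R → IsUnit R.det → ∀ s : ℂ,
      ‖Φ hidx X₀ R s‖ = 8⁻¹ * (‖C.det‖ ^ 4)⁻¹ * (‖R.det‖ ^ (2 - 2 * s.re) * ‖FJ (R * ((C⁻¹)ᴴ * hidx * C⁻¹) * R) s‖) := by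
    intro hidx hpos X₀ R hX₀ hR hRu s
    have hRdet : R.det ≠ 0 := hRu.ne_zero
    have hRpos : 0 < ‖R.det‖ := norm_pos_iff.2 hRdet
    have hK₀n : ‖cexp ((2 * Real.pi * I) * (((C⁻¹)ᴴ * hidx * C⁻¹) * X₀).trace)‖ = 1 := norm_cexp_trace_mul_of_isHermitian (h₁pd hidx hpos).1 hX₀
    have hχn : ‖(conj R⁻¹.det / ((‖R⁻¹.det‖ : ℝ) : ℂ)) ^ k‖ = 1 := by
      have hne : R⁻¹.det ≠ 0 := by
        rw [Matrix.det_nonsing_inv, Ring.inverse_eq_inv']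
        exact inv_ne_zero hRdet
      exact norm_archChar_eq_one hne k
    have hpow : ‖(((‖R.det‖ : ℝ) : ℂ) ^ (2 - 2 * s))‖ = ‖R.det‖ ^ (2 - 2 * s.re) := by
      rw [Complex.norm_cpow_eq_rpow_re_of_pos hRpos]
      congr 1; simp [Complex.sub_re, Complex.mul_re]
    simp only [hΦ]
    rw [hR, norm_mul, norm_mul, norm_mul, norm_mul, norm_mul, hK₀n, hχn, one_mul, one_mul, hpow, norm_inv, norm_pow,
      Complex.norm_real, Real.norm_eq_abs, abs_norm]
    have h8 : ‖(1 / 8 : ℂ)‖ = 8⁻¹ := by norm_num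
    rw [h8]; ring
  /- the family -/
  refine ⟨fun hidx g => if hS : ∃ X₀ R : Matrix (Fin 2) (Fin 2) ℂ, X₀ᴴ = X₀ ∧ Rᴴ = R ∧ IsUnit R.det ∧
        (fromBlocks C 0 0 (-B) : Matrix (Fin 2 ⊕ Fin 2) (Fin 2 ⊕ Fin 2) ℂ) * g = fromBlocks 1 X₀ 0 1 * fromBlocks R 0 0 R⁻¹ then
        Φ hidx hS.choose hS.choose_spec.choose
      else if hg : gᴴ * Matrix.J (Fin 2) ℂ * g = Matrix.J (Fin 2) ℂ ∧ hidx.PosDef then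
        Classical.choose (exists_twistedWhittaker_growth_of_posDef_pic hk Pic hx hg.1 hg.2
          (eb := fun b => cexp (-(2 * Real.pi * I) * (hidx * b).trace)) (fun _ => rfl) hKpic)
      else fun _ => 0, fun hidx hpos eb heb g hg => ?_, fun z hz => ?_⟩
  · -- holomorphy and the formula for every index and every `g ∈ U(J)`
    beta_reduce
    by_cases hS : ∃ X₀ R : Matrix (Fin 2) (Fin 2) ℂ, X₀ᴴ = X₀ ∧ Rᴴ = R ∧ IsUnit R.det ∧
        (fromBlocks C 0 0 (-B) : Matrix (Fin 2 ⊕ Fin 2) (Fin 2 ⊕ Fin 2) ℂ) * g = fromBlocks 1 X₀ 0 1 * fromBlocks R 0 0 R⁻¹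
    · obtain ⟨hX₀c, hRc, hRcu, hdecc⟩ := hS.choose_spec.choose_spec
      simp only [dif_pos hS]
      refine ⟨hΦhol hidx hpos _ _ hRc hRcu, s₀, fun s hs F hF hFQ => ?_⟩
      rw [hform hidx hpos eb heb g hg _ _ hX₀c hRc hRcu hdecc s hs F hF hFQ]
    · have hg' : gᴴ * Matrix.J (Fin 2) ℂ * g = Matrix.J (Fin 2) ℂ ∧ hidx.PosDef := ⟨hg, hpos⟩
      simp only [dif_neg hS, dif_pos hg']
      obtain ⟨s₁, hhol, hEw, -⟩ := Classical.choose_spec (exists_twistedWhittaker_growth_of_posDef_pic hk Pic hx hg'.1 hg'.2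
        (eb := fun b => cexp (-(2 * Real.pi * I) * (hidx * b).trace)) (fun _ => rfl) hKpic)
      refine ⟨hhol, s₁, fun s hs F hF hFQ => ?_⟩
      simp only [heb]
      exact hEw s hs F hF hFQ
  · /- the uniform growth on the ball `dist s z < re z ∕ 2` -/
    set r : ℝ := z.re / 2 with hr
    have hr0 : 0 < r := by rw [hr]; linarith
    have hKc : IsCompact (Metric.closedBall z r) := isCompact_closedBall z r
    have hKre : ∀ s ∈ Metric.closedBall z r, 0 < s.re := by
      intro s hs
      have h1 : |(s - z).re| ≤ ‖s - z‖ := Complex.abs_re_le_norm (s - z)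
      rw [Metric.mem_closedBall, dist_eq_norm] at hs
      rw [Complex.sub_re] at h1
      have h2 := (abs_le.1 (h1.trans hs)).1
      rw [hr] at h2; linarith
    obtain ⟨Cg, N, N', hCg, hN, hN', hB⟩ := hFJgr hKc (fun s hs => hwin s (hKre s hs))
    refine ⟨8⁻¹ * (‖C.det‖ ^ 4)⁻¹ * Cg, Real.pi / 2, N, N', r, by positivity, by positivity, hN, hN', hr0,
      fun hidx hpos eb _ g _ X₀ R hX₀ hR hRu hdec s hs => ?_⟩
    beta_reduce
    have hS : ∃ X₀ R : Matrix (Fin 2) (Fin 2) ℂ, X₀ᴴ = X₀ ∧ Rᴴ = R ∧ IsUnit R.det ∧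
        (fromBlocks C 0 0 (-B) : Matrix (Fin 2 ⊕ Fin 2) (Fin 2 ⊕ Fin 2) ℂ) * g = fromBlocks 1 X₀ 0 1 * fromBlocks R 0 0 R⁻¹ := ⟨X₀, R, hX₀, hR, hRu, hdec⟩
    obtain ⟨hX₀c, hRc, hRcu, hdecc⟩ := hS.choose_spec.choose_spec
    simp only [dif_pos hS]
    have hsK : s ∈ Metric.closedBall z r := Metric.mem_closedBall.2 hs.le
    set h₁ : Matrix (Fin 2) (Fin 2) ℂ := (C⁻¹)ᴴ * hidx * C⁻¹ with hh₁
    set h₂' : Matrix (Fin 2) (Fin 2) ℂ := R * h₁ * R with hh₂'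
    have h₂'pos : h₂'.PosDef := hRpd hidx hpos R hR hRu
    obtain ⟨htr0', htrle', hT2le', -⟩ := entryLetters_of_posDef h₂'pos
    have hRp : 0 ≤ ‖R.det‖ ^ (2 - 2 * s.re) := Real.rpow_nonneg (norm_nonneg _) _
    /- the bound for ANY Siegel-form decomposition `(X₁, R₁)` of `diag(C,−B)·g` — it differs from `(X₀, R)` by a unitary `κ` -/
    have key : ∀ X₁ R₁ : Matrix (Fin 2) (Fin 2) ℂ, X₁ᴴ = X₁ → R₁ᴴ = R₁ → IsUnit R₁.det →
        (fromBlocks C 0 0 (-B) : Matrix (Fin 2 ⊕ Fin 2) (Fin 2 ⊕ Fin 2) ℂ) * g = fromBlocks 1 X₁ 0 1 * fromBlocks R₁ 0 0 R₁⁻¹ →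
        ‖Φ hidx X₁ R₁ s‖ ≤ 8⁻¹ * (‖C.det‖ ^ 4)⁻¹ * Cg * ‖R.det‖ ^ (2 - 2 * s.re) * Real.exp (-(Real.pi / 2 * ∑ a, ∑ b, ‖h₂' a b‖)) *
            (1 + ∑ a, ∑ b, ‖h₂' a b‖) ^ N * (1 + ‖h₂'.det‖ ^ (-N')) := by
      intro X₁ R₁ hX₁ hR₁ hR₁u hdec₁
      rw [hΦnorm hidx hpos X₁ R₁ hX₁ hR₁ hR₁u s, ← hh₁]
      have hcmp : (fromBlocks 1 X₁ 0 1 : Matrix (Fin 2 ⊕ Fin 2) (Fin 2 ⊕ Fin 2) ℂ) * fromBlocks R₁ 0 0 R₁⁻¹ * 1 =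
          fromBlocks 1 X₀ 0 1 * fromBlocks R 0 0 R⁻¹ * 1 := by
        rw [Matrix.mul_one, Matrix.mul_one, ← hdec₁, hdec]
      obtain ⟨κ, hκ1, hκ2, hRκ⟩ := levi_letters_unique hRu h1J (moeb_one _) h1J (moeb_one _) hcmp
      have hRκ' : R₁ = κᴴ * R := by rw [← hR₁, hRκ, conjTranspose_mul, hR]
      set h₂ : Matrix (Fin 2) (Fin 2) ℂ := R₁ * h₁ * R₁ with hh₂
      have h₂pos : h₂.PosDef := hRpd hidx hpos R₁ hR₁ hR₁u
      have hFJ := hB h₂ h₂pos s hsK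
      have hconj : h₂ = κᴴ * h₂' * κ := by
        rw [hh₂, hh₂']
        calc R₁ * h₁ * R₁ = κᴴ * R * h₁ * (R * κ) := by rw [← hRκ', ← hRκ]
          _ = κᴴ * (R * h₁ * R) * κ := by simp only [Matrix.mul_assoc]
      have hdκ : κᴴ.det * κ.det = 1 := by rw [← Matrix.det_mul, hκ1, Matrix.det_one]
      have hnκ : ‖κ.det‖ = 1 := by
        have h := congrArg norm hdκ
        rw [norm_mul, Matrix.det_conjTranspose, norm_star, norm_one] at h
        nlinarith [norm_nonneg κ.det]
      have hdetR : ‖R₁.det‖ = ‖R.det‖ := by rw [hRκ, Matrix.det_mul, norm_mul, hnκ, mul_one]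
      have htr : (h₂ 0 0).re + (h₂ 1 1).re = (h₂' 0 0).re + (h₂' 1 1).re := by
        have h : h₂.trace = h₂'.trace := by
          rw [hconj, Matrix.trace_mul_cycle, hκ2, Matrix.one_mul]
        rw [Matrix.trace_fin_two, Matrix.trace_fin_two] at h
        have h' := congrArg Complex.re h
        simpa only [Complex.add_re] using h'
      have hdet2 : h₂.det = h₂'.det := by
        rw [hconj, Matrix.det_mul, Matrix.det_mul]
        calc κᴴ.det * h₂'.det * κ.det = h₂'.det * (κᴴ.det * κ.det) := by ring
          _ = h₂'.det := by rw [hdκ, mul_one]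
      obtain ⟨htr0, -, -, hdet⟩ := entryLetters_of_posDef h₂pos
      rw [hdetR, ← hdet2, hdet]
      have hexp : Real.exp (-(Real.pi * ((h₂ 0 0).re + (h₂ 1 1).re))) ≤ Real.exp (-(Real.pi / 2 * ∑ a, ∑ b, ‖h₂' a b‖)) := by
        rw [Real.exp_le_exp, htr]
        nlinarith [hT2le', Real.pi_pos]
      have hpol : (1 + ((h₂ 0 0).re + (h₂ 1 1).re)) ^ N ≤ (1 + ∑ a, ∑ b, ‖h₂' a b‖) ^ N :=
        Real.rpow_le_rpow (by linarith [htr, htr0']) (by linarith [htr, htrle']) hN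
      have hdet0 : 0 ≤ 1 + ((h₂ 0 0).re * (h₂ 1 1).re - normSq (h₂ 0 1)) ^ (-N') := by
        have := K2LiuHermTwoConfluentXiRegularity.det_re_pos_of_posDef h₂pos
        positivity
      calc 8⁻¹ * (‖C.det‖ ^ 4)⁻¹ * (‖R.det‖ ^ (2 - 2 * s.re) * ‖FJ h₂ s‖)
          ≤ 8⁻¹ * (‖C.det‖ ^ 4)⁻¹ * (‖R.det‖ ^ (2 - 2 * s.re) * (Cg * Real.exp (-(Real.pi * ((h₂ 0 0).re + (h₂ 1 1).re))) *
              (1 + ((h₂ 0 0).re + (h₂ 1 1).re)) ^ N * (1 + ((h₂ 0 0).re * (h₂ 1 1).re - normSq (h₂ 0 1)) ^ (-N')))) := by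
            gcongr
        _ ≤ 8⁻¹ * (‖C.det‖ ^ 4)⁻¹ * (‖R.det‖ ^ (2 - 2 * s.re) * (Cg * Real.exp (-(Real.pi / 2 * ∑ a, ∑ b, ‖h₂' a b‖)) *
              (1 + ∑ a, ∑ b, ‖h₂' a b‖) ^ N * (1 + ((h₂ 0 0).re * (h₂ 1 1).re - normSq (h₂ 0 1)) ^ (-N')))) := by
            gcongr
        _ = 8⁻¹ * (‖C.det‖ ^ 4)⁻¹ * Cg * ‖R.det‖ ^ (2 - 2 * s.re) * Real.exp (-(Real.pi / 2 * ∑ a, ∑ b, ‖h₂' a b‖)) *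
              (1 + ∑ a, ∑ b, ‖h₂' a b‖) ^ N * (1 + ((h₂ 0 0).re * (h₂ 1 1).re - normSq (h₂ 0 1)) ^ (-N')) := by ring
    exact key _ _ hX₀c hRc hRcu hdecc

end Summit.HodgeConjecture.HodgeConjecture.Cruxes.HLiu418.K2LiuKindWArchWhittakerGrowthAtOnePic

end
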